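/-
Copyright (c) 2026. All rights reserved.
Released under Apache 2.0 license as described in the file LICENSE.
Authors: abc-iut cell, seat abc-iut-w5-d226 (gen 3; ROW «P13-INPUT-BRIDGE», L4-lead RULING #5i (3)).
-/
import Literature.AnabelianGeometry.AbsoluteAnabelian.AbsTopII.DPSCDataOfSemiGraph
import Literature.AnabelianGeometry.SemiGraphs.CommensurableTerminalityLemmas
import HarnessLib

/-!
# [AbsTopII] Prop 1.3 over a PSC-presented DPSC datum: graphicity from [CombGC] Def 1.4 (i), and the
# typed conclusions (vii), (v), (vi), (ix), (iii) with the `Π_𝔾`-inputs read from layer L3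

S. Mochizuki, *Topics in Absolute Anabelian Geometry II* [AbsTopII] (bib `MochizukiAbsTopII2013`; kurims
manuscript `paper:url-585b8d0ad0d9`), §1 Def 1.2 (ii) p. 10 ("`ρ_H : H → Aut(𝒢) (⊆ Out(Π_𝒢))`",
`Π_H := Π_𝒢 ⋊^out H`) and Prop 1.3 pp. 11–12; [CombGC] (bib `MochizukiCombGC2007`) Def 1.4 (i) p. 10
("graphic").

PROOF-ONLY companion of `AbsTopII/DPSCDataOfSemiGraph.lean` (same presentation hypotheses `hV`, `hN`,
`hC` of a DPSC datum `X` by a PSC datum `G : PSCDatum ↥X.PiG` of layer L3):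

* input row I-GR of `plan/L4/SUBDAG-AbsTopII-Prop13.md` ("every `Π_H`-conjugate of `Π_v` is a
  `Π_𝔾`-conjugate of some `Π_{v'}`", the `hGRv`/`hGraphic` hypothesis of abc-iut-L4's files (A)/(B) and of
  abc-iut f-065's `isOpen_map_Dv`) ⇐ `hgr`: conjugation by every `h ∈ Π_H` agrees on `Π_𝔾` with a
  continuous automorphism that is GRAPHIC for `G` in the sense of [CombGC] Def 1.4 (i)
  (`PSCDatum.IsGraphic`) — the kernel reading of "`ρ_H` takes values in `Aut(𝒢) ⊆ Out(Π_𝒢)`"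
  (`graphic_vertSub_of_psc`, `graphic_nodeSub_of_psc`, `graphic_cuspSub_of_psc`);
* the typed conclusions with every `Π_𝔾`-input now a layer-L3 predicate on `G` ([CombGC] Prop 1.2
  (i)/(ii): `VerticialOpenInterDeterminesVertex` / `EdgeLikeOpenInterDeterminesEdge` /
  `VerticialEdgeLikeCommensurablyTerminal`) or the graphicity `hgr`: `prop13vii_of_psc` (F-0280),
  `prop13v_of_psc` (F-0278), `prop13vi_of_psc` (F-0279 — no other input left), `prop13ix_of_psc`
  (F-0277), `prop13iii_of_psc` (F-0275).

What stays a hypothesis BY NAME (no layer-L3 decl today): `Π_𝔾` slim nontrivial, `Π_v` slim ([CombGC]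
Rmk 1.1.3), "(iv) at open subgroups" (`hL`), `I_v` infinite / `I_v ↠ I` / `Π_e ≤ I_e` (Prop 1.3
(ii)(iii)), `Π_e` abelian for cusps (Prop 1.3 (i)).  HONEST FRAMING: classical group theory over two typed
interfaces; typed ≠ proved; nothing here bears on [IUTchIII] Cor 3.12 or takes a side on any author.
-/

open scoped Pointwise

namespace Literature.AnabelianGeometry.AbsoluteAnabelian

open Literature.AlgebraicGeometry.Frobenioids (IsSlimGroup)
open Literature.AnabelianGeometry.SemiGraphs

universe u

namespace DPSCData

variable (X : DPSCData.{u}) (G : PSCDatum ↥X.PiG)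
  (eV : X.Vert ≃ G.graph.V) (eN : X.Node ≃ G.graph.N) (eC : X.Cusp ≃ G.graph.C)

/-! ### I-GR ⇐ [CombGC] Def 1.4 (i) "graphic" for the conjugation action of `Π_H` -/

/-- **Input I-GR (vertices) from layer L3**: if conjugation by every `h ∈ Π_H` restricts on `Π_𝔾` to a
GRAPHIC automorphism of (`Π_𝔾`, `G`) ([CombGC] Def 1.4 (i): it carries `[Π_w] ↦ [Π_{ι w}]` for an
automorphism `ι` of the underlying semi-graph — the reading of [AbsTopII] Def 1.2 (ii)
"`ρ_H : H → Aut(𝒢) (⊆ Out(Π_𝒢))`"), then every `Π_H`-conjugate of `Π_v` is a `Π_𝔾`-conjugate of some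
`Π_{v'}` — the hypothesis `hGRv` / `hGraphic` of files (A)/(B) and of `isOpen_map_Dv`.
[cite: MochizukiAbsTopII2013, Def 1.2 (ii) p.10] [cite: MochizukiCombGC2007, Def 1.4(i) p.10] -/
theorem graphic_vertSub_of_psc
    (hV : ∀ v, ∃ δ : ConjAct ↥X.PiG, (X.vertSub v).subgroupOf X.PiG = δ • G.vertGp (eV v))
    (hgr : ∀ h : X.PiH, ∃ α : ↥X.PiG ≃ₜ* ↥X.PiG,
      (∀ x : ↥X.PiG, ((α x : ↥X.PiG) : X.PiH) = h * x * h⁻¹) ∧ G.IsGraphic G α) :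
    ∀ (g : X.PiH) (v : X.Vert), ∃ v' : X.Vert, ∃ γ ∈ X.PiG,
      MulAut.conj g • X.vertSub v = MulAut.conj γ • X.vertSub v' := by
  haveI := X.normal_PiG
  intro g v
  obtain ⟨α, hα, ι, hιV, -, -⟩ := hgr g
  obtain ⟨δ, hδ⟩ := hV v
  obtain ⟨c, hc⟩ := hιV (eV v)
  obtain ⟨δ', hδ'⟩ := hV (eV.symm (ι.vertEquiv (eV v)))
  rw [Equiv.apply_symm_apply] at hδ'
  set γ : ↥X.PiG :=
    ConjAct.ofConjAct (ConjAct.toConjAct (α.toMulEquiv (ConjAct.ofConjAct δ)) * c * δ'⁻¹) with hγ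
  refine ⟨eV.symm (ι.vertEquiv (eV v)), γ, γ.2, ?_⟩
  apply eq_of_subgroupOf_eq X.PiG (mulAut_conj_smul_le_of_normal X.PiG (X.vertSub_le v) g)
    (mulAut_conj_smul_le_of_normal X.PiG (X.vertSub_le _) _)
  rw [subgroupOf_conj_smul_eq_map X.PiG (X.vertSub v) g α.toMulEquiv (fun x => hα x), hδ,
    ← ConjAct.toConjAct_ofConjAct δ, map_conjAct_smul, MulEquiv.coe_toMonoidHom]
  erw [hc]
  rw [subgroupOf_conj_smul_of_mem, hδ', ← mul_smul, ← mul_smul, hγ, ConjAct.toConjAct_ofConjAct,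
    inv_mul_cancel_right]

/-- **Input I-GR (nodes) from layer L3.** [cite: MochizukiAbsTopII2013, Def 1.2 (ii) p.10] -/
theorem graphic_nodeSub_of_psc
    (hN : ∀ e, ∃ δ : ConjAct ↥X.PiG, (X.nodeSub e).subgroupOf X.PiG = δ • G.nodeGp (eN e))
    (hgr : ∀ h : X.PiH, ∃ α : ↥X.PiG ≃ₜ* ↥X.PiG,
      (∀ x : ↥X.PiG, ((α x : ↥X.PiG) : X.PiH) = h * x * h⁻¹) ∧ G.IsGraphic G α) :
    ∀ (g : X.PiH) (e : X.Node), ∃ e' : X.Node, ∃ γ ∈ X.PiG,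
      MulAut.conj g • X.nodeSub e = MulAut.conj γ • X.nodeSub e' := by
  haveI := X.normal_PiG
  intro g e
  obtain ⟨α, hα, ι, -, hιN, -⟩ := hgr g
  obtain ⟨δ, hδ⟩ := hN e
  obtain ⟨c, hc⟩ := hιN (eN e)
  obtain ⟨δ', hδ'⟩ := hN (eN.symm (ι.nodeEquiv (eN e)))
  rw [Equiv.apply_symm_apply] at hδ'
  set γ : ↥X.PiG :=
    ConjAct.ofConjAct (ConjAct.toConjAct (α.toMulEquiv (ConjAct.ofConjAct δ)) * c * δ'⁻¹) with hγ
  refine ⟨eN.symm (ι.nodeEquiv (eN e)), γ, γ.2, ?_⟩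
  apply eq_of_subgroupOf_eq X.PiG (mulAut_conj_smul_le_of_normal X.PiG (X.nodeSub_le e) g)
    (mulAut_conj_smul_le_of_normal X.PiG (X.nodeSub_le _) _)
  rw [subgroupOf_conj_smul_eq_map X.PiG (X.nodeSub e) g α.toMulEquiv (fun x => hα x), hδ,
    ← ConjAct.toConjAct_ofConjAct δ, map_conjAct_smul, MulEquiv.coe_toMonoidHom]
  erw [hc]
  rw [subgroupOf_conj_smul_of_mem, hδ', ← mul_smul, ← mul_smul, hγ, ConjAct.toConjAct_ofConjAct,
    inv_mul_cancel_right]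

/-- **Input I-GR (cusps) from layer L3.** [cite: MochizukiAbsTopII2013, Def 1.2 (ii) p.10] -/
theorem graphic_cuspSub_of_psc
    (hC : ∀ e, ∃ δ : ConjAct ↥X.PiG, (X.cuspSub e).subgroupOf X.PiG = δ • G.cuspGp (eC e))
    (hgr : ∀ h : X.PiH, ∃ α : ↥X.PiG ≃ₜ* ↥X.PiG,
      (∀ x : ↥X.PiG, ((α x : ↥X.PiG) : X.PiH) = h * x * h⁻¹) ∧ G.IsGraphic G α) :
    ∀ (g : X.PiH) (e : X.Cusp), ∃ e' : X.Cusp, ∃ γ ∈ X.PiG,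
      MulAut.conj g • X.cuspSub e = MulAut.conj γ • X.cuspSub e' := by
  haveI := X.normal_PiG
  intro g e
  obtain ⟨α, hα, ι, -, -, hιC⟩ := hgr g
  obtain ⟨δ, hδ⟩ := hC e
  obtain ⟨c, hc⟩ := hιC (eC e)
  obtain ⟨δ', hδ'⟩ := hC (eC.symm (ι.cuspEquiv (eC e)))
  rw [Equiv.apply_symm_apply] at hδ'
  set γ : ↥X.PiG :=
    ConjAct.ofConjAct (ConjAct.toConjAct (α.toMulEquiv (ConjAct.ofConjAct δ)) * c * δ'⁻¹) with hγ
  refine ⟨eC.symm (ι.cuspEquiv (eC e)), γ, γ.2, ?_⟩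
  apply eq_of_subgroupOf_eq X.PiG (mulAut_conj_smul_le_of_normal X.PiG (X.cuspSub_le e) g)
    (mulAut_conj_smul_le_of_normal X.PiG (X.cuspSub_le _) _)
  rw [subgroupOf_conj_smul_eq_map X.PiG (X.cuspSub e) g α.toMulEquiv (fun x => hα x), hδ,
    ← ConjAct.toConjAct_ofConjAct δ, map_conjAct_smul, MulEquiv.coe_toMonoidHom]
  erw [hc]
  rw [subgroupOf_conj_smul_of_mem, hδ', ← mul_smul, ← mul_smul, hγ, ConjAct.toConjAct_ofConjAct,
    inv_mul_cancel_right]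

/-! ### The typed conclusions of Prop 1.3 with the `Π_𝔾`-inputs read from layer L3 -/

/-- **[AbsTopII] Prop 1.3 (vii) as typed** (`DPSCData.Prop13vii`, F-0280) for DPSC data presented by a
PSC datum: the `Π_𝔾`-inputs of `prop13vii_of_inputs` (file (B)) are now [CombGC] Prop 1.2 (i)/(ii) FOR
`G` (layer L3 predicates) and graphicity of the conjugation action; the Prop 1.3 (ii) clauses
`Π_e ≤ I_e`, `I_e·Π_𝔾 = Π_I` stay the hypothesis `hii`. [cite: MochizukiAbsTopII2013, Prop 1.3 (vii) p.12] -/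
theorem prop13vii_of_psc
    (hN : ∀ e, ∃ δ : ConjAct ↥X.PiG, (X.nodeSub e).subgroupOf X.PiG = δ • G.nodeGp (eN e))
    (hC : ∀ e, ∃ δ : ConjAct ↥X.PiG, (X.cuspSub e).subgroupOf X.PiG = δ • G.cuspGp (eC e))
    (hCT : G.VerticialEdgeLikeCommensurablyTerminal) (hDet : G.EdgeLikeOpenInterDeterminesEdge)
    (hgr : ∀ h : X.PiH, ∃ α : ↥X.PiG ≃ₜ* ↥X.PiG,
      (∀ x : ↥X.PiG, ((α x : ↥X.PiG) : X.PiH) = h * x * h⁻¹) ∧ G.IsGraphic G α)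
    (hii : ∀ e : X.Node, X.nodeSub e ≤ X.IvNode e ∧ X.IvNode e ⊔ X.PiG = X.PiI) :
    X.Prop13vii :=
  X.prop13vii_of_inputs (X.graphic_nodeSub_of_psc G eN hN hgr) (X.nodeDet_of_psc G eN hN hDet)
    (X.isCommensurablyTerminal_nodeSub_of_psc G eN hN hCT) (X.graphic_cuspSub_of_psc G eC hC hgr)
    (X.cuspDet_of_psc G eC hC hDet) (X.isCommensurablyTerminal_cuspSub_of_psc G eC hC hCT) hii

/-- **[AbsTopII] Prop 1.3 (v) (outer clauses) as typed** (`DPSCData.Prop13v`, F-0278) for DPSC data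
presented by a PSC datum: `Π_𝔾`-inputs from layer L3 + graphicity; "(iv) at open subgroups" (`hL`)
and "`I_v` infinite" (`hinf`, Prop 1.3 (iii)) stay hypotheses. [cite: MochizukiAbsTopII2013, Prop 1.3 (v) p.12] -/
theorem prop13v_of_psc
    (hV : ∀ v, ∃ δ : ConjAct ↥X.PiG, (X.vertSub v).subgroupOf X.PiG = δ • G.vertGp (eV v))
    (hCT : G.VerticialEdgeLikeCommensurablyTerminal) (hDetV : G.VerticialOpenInterDeterminesVertex)
    (hgr : ∀ h : X.PiH, ∃ α : ↥X.PiG ≃ₜ* ↥X.PiG,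
      (∀ x : ↥X.PiG, ((α x : ↥X.PiG) : X.PiH) = h * x * h⁻¹) ∧ G.IsGraphic G α)
    (hL : ∀ (v : X.Vert) (g : X.PiH), X.Iv v ⊓ MulAut.conj g • X.Iv v ≠ ⊥ →
      MulAut.conj g • X.vertSub v = X.vertSub v)
    (hinf : ∀ v : X.Vert, Infinite ↥(X.Iv v)) : X.Prop13v :=
  X.prop13v_of_inputs (X.graphic_vertSub_of_psc G eV hV hgr) (X.vertDet_of_psc G eV hV hDetV)
    (X.isCommensurablyTerminal_vertSub_of_psc G eV hV hCT) hL hinf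

/-- **[AbsTopII] Prop 1.3 (vi) as typed** (`DPSCData.Prop13vi`, F-0279) for DPSC data presented by a
PSC datum — EVERY input is now a layer-L3 predicate on `G` ([CombGC] Prop 1.2 (i)/(ii)) or the
graphicity of the conjugation action: both halves of (vi) ("the image of `D_v` in `H` is open",
abc-iut f-065's `isOpen_map_Dv`, finiteness of `𝔾` being the `Fintype` field of `G.graph`; "`D_v` is
not open in `Π_H`", file (C)). [cite: MochizukiAbsTopII2013, Prop 1.3 (vi) p.12] -/
theorem prop13vi_of_psc
    (hV : ∀ v, ∃ δ : ConjAct ↥X.PiG, (X.vertSub v).subgroupOf X.PiG = δ • G.vertGp (eV v))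
    (hCT : G.VerticialEdgeLikeCommensurablyTerminal) (hDetV : G.VerticialOpenInterDeterminesVertex)
    (hgr : ∀ h : X.PiH, ∃ α : ↥X.PiG ≃ₜ* ↥X.PiG,
      (∀ x : ↥X.PiG, ((α x : ↥X.PiG) : X.PiH) = h * x * h⁻¹) ∧ G.IsGraphic G α) :
    X.Prop13vi := by
  haveI : Finite X.Vert := Finite.of_equiv _ eV.symm
  exact X.prop13vi_of_inputs' (X.isClosed_vertSub_of_psc G eV hV) (X.graphic_vertSub_of_psc G eV hV hgr)
    (X.vertDet_isOpen_form_of_psc G eV hV hDetV) (X.isCommensurablyTerminal_vertSub_of_psc G eV hV hCT)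

/-- **[AbsTopII] Prop 1.3 (ix) as typed** (`DPSCData.Prop13ix`, F-0277) for DPSC data presented by a
PSC datum: `Π_𝔾`-inputs from layer L3 + graphicity (first halves via abc-iut f-065's
`isOpen_map_DvNode` / `isOpen_map_DvCusp`); `Π_𝔾` slim nontrivial ([CombGC] Rmk 1.1.3, not typed in
layer L3), `Π_e ≤ I_e` (Prop 1.3 (ii)) and "`Π_e` abelian" for cusps (Prop 1.3 (i)) stay hypotheses.
[cite: MochizukiAbsTopII2013, Prop 1.3 (ix) p.12] -/
theorem prop13ix_of_psc [Nontrivial ↥X.PiG] (hslim : IsSlimGroup ↥X.PiG)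
    (hN : ∀ e, ∃ δ : ConjAct ↥X.PiG, (X.nodeSub e).subgroupOf X.PiG = δ • G.nodeGp (eN e))
    (hC : ∀ e, ∃ δ : ConjAct ↥X.PiG, (X.cuspSub e).subgroupOf X.PiG = δ • G.cuspGp (eC e))
    (hCT : G.VerticialEdgeLikeCommensurablyTerminal)
    (hgr : ∀ h : X.PiH, ∃ α : ↥X.PiG ≃ₜ* ↥X.PiG,
      (∀ x : ↥X.PiG, ((α x : ↥X.PiG) : X.PiH) = h * x * h⁻¹) ∧ G.IsGraphic G α)
    (hii : ∀ e : X.Node, X.nodeSub e ≤ X.IvNode e)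
    (hab : ∀ e : X.Cusp, ∀ x ∈ X.cuspSub e, ∀ y ∈ X.cuspSub e, x * y = y * x) : X.Prop13ix := by
  haveI : Finite X.Node := Finite.of_equiv _ eN.symm
  haveI : Finite X.Cusp := Finite.of_equiv _ eC.symm
  exact X.prop13ix_of_inputs' hslim (X.isClosed_nodeSub_of_psc G eN hN) (X.isClosed_cuspSub_of_psc G eC hC)
    (X.graphic_nodeSub_of_psc G eN hN hgr) (X.graphic_cuspSub_of_psc G eC hC hgr)
    (X.isCommensurablyTerminal_nodeSub_of_psc G eN hN hCT)
    (X.isCommensurablyTerminal_cuspSub_of_psc G eC hC hCT) hii hab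

/-- **[AbsTopII] Prop 1.3 (iii), first clauses, as typed** (`DPSCData.Prop13iii`, F-0275) for DPSC data
presented by a PSC datum: commensurable terminality of `Π_v` from layer L3; `Π_v` slim ([CombGC]
Rmk 1.1.3) and "`I_v ↠ I`" stay hypotheses. [cite: MochizukiAbsTopII2013, Prop 1.3 (iii) p.11] -/
theorem prop13iii_of_psc
    (hV : ∀ v, ∃ δ : ConjAct ↥X.PiG, (X.vertSub v).subgroupOf X.PiG = δ • G.vertGp (eV v))
    (hCT : G.VerticialEdgeLikeCommensurablyTerminal) (hslimv : ∀ v : X.Vert, IsSlimGroup ↥(X.vertSub v))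
    (hsurj : ∀ v : X.Vert, X.Iv v ⊔ X.PiG = X.PiI) : X.Prop13iii :=
  X.prop13iii_of_inputs (X.isCommensurablyTerminal_vertSub_of_psc G eV hV hCT) hslimv hsurj

/-! ### The same at the level of layer L3's printed facts (FACT-LIST F-0438, F-0459) -/

/-- **[AbsTopII] Prop 1.3 (vi) (F-0279) modulo the FROZEN facts F-0438 + F-0459 and graphicity**: for a
DPSC datum presented by a PSC datum `G` OF PSC-TYPE (`Ω.IsOfPSCType G`, the origin certificate of layer
L3), [CombGC] Prop 1.2 (ii) as printed (`PSCDatum.CommensurableTerminalityHolds Ω`, F-0438) and Prop 1.2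
(i) as printed (`PSCDatum.OpenInterDeterminesComponentHolds Ω`, F-0459) leave graphicity of the
conjugation action (`hgr`, Def 1.2 (ii)) as the ONLY other input of (vi).
[cite: MochizukiAbsTopII2013, Prop 1.3 (vi) p.12] [cite: MochizukiCombGC2007, Prop 1.2 p.8] -/
theorem prop13vi_of_pscOrigin (Ω : PSCOrigin.{u}) (hΩ : Ω.IsOfPSCType G)
    (hF0438 : PSCDatum.CommensurableTerminalityHolds Ω)
    (hF0459 : PSCDatum.OpenInterDeterminesComponentHolds Ω)
    (hV : ∀ v, ∃ δ : ConjAct ↥X.PiG, (X.vertSub v).subgroupOf X.PiG = δ • G.vertGp (eV v))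
    (hgr : ∀ h : X.PiH, ∃ α : ↥X.PiG ≃ₜ* ↥X.PiG,
      (∀ x : ↥X.PiG, ((α x : ↥X.PiG) : X.PiH) = h * x * h⁻¹) ∧ G.IsGraphic G α) :
    X.Prop13vi :=
  X.prop13vi_of_psc G eV hV (hF0438 G hΩ).1 (hF0459 G hΩ).1 hgr

/-- **[AbsTopII] Prop 1.3 (vii) (F-0280) modulo F-0438 + F-0459, graphicity and the Prop 1.3 (ii)
clauses** (`hii`). [cite: MochizukiAbsTopII2013, Prop 1.3 (vii) p.12] [cite: MochizukiCombGC2007, Prop 1.2 p.8] -/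
theorem prop13vii_of_pscOrigin (Ω : PSCOrigin.{u}) (hΩ : Ω.IsOfPSCType G)
    (hF0438 : PSCDatum.CommensurableTerminalityHolds Ω)
    (hF0459 : PSCDatum.OpenInterDeterminesComponentHolds Ω)
    (hN : ∀ e, ∃ δ : ConjAct ↥X.PiG, (X.nodeSub e).subgroupOf X.PiG = δ • G.nodeGp (eN e))
    (hC : ∀ e, ∃ δ : ConjAct ↥X.PiG, (X.cuspSub e).subgroupOf X.PiG = δ • G.cuspGp (eC e))
    (hgr : ∀ h : X.PiH, ∃ α : ↥X.PiG ≃ₜ* ↥X.PiG,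
      (∀ x : ↥X.PiG, ((α x : ↥X.PiG) : X.PiH) = h * x * h⁻¹) ∧ G.IsGraphic G α)
    (hii : ∀ e : X.Node, X.nodeSub e ≤ X.IvNode e ∧ X.IvNode e ⊔ X.PiG = X.PiI) :
    X.Prop13vii :=
  X.prop13vii_of_psc G eN eC hN hC (hF0438 G hΩ).1 (hF0459 G hΩ).2.1 hgr hii

/-- **[AbsTopII] Prop 1.3 (v) (F-0278) modulo F-0438 + F-0459, graphicity, "(iv) at open subgroups" and
"`I_v` infinite".** [cite: MochizukiAbsTopII2013, Prop 1.3 (v) p.12] [cite: MochizukiCombGC2007, Prop 1.2 p.8] -/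
theorem prop13v_of_pscOrigin (Ω : PSCOrigin.{u}) (hΩ : Ω.IsOfPSCType G)
    (hF0438 : PSCDatum.CommensurableTerminalityHolds Ω)
    (hF0459 : PSCDatum.OpenInterDeterminesComponentHolds Ω)
    (hV : ∀ v, ∃ δ : ConjAct ↥X.PiG, (X.vertSub v).subgroupOf X.PiG = δ • G.vertGp (eV v))
    (hgr : ∀ h : X.PiH, ∃ α : ↥X.PiG ≃ₜ* ↥X.PiG,
      (∀ x : ↥X.PiG, ((α x : ↥X.PiG) : X.PiH) = h * x * h⁻¹) ∧ G.IsGraphic G α)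
    (hL : ∀ (v : X.Vert) (g : X.PiH), X.Iv v ⊓ MulAut.conj g • X.Iv v ≠ ⊥ →
      MulAut.conj g • X.vertSub v = X.vertSub v)
    (hinf : ∀ v : X.Vert, Infinite ↥(X.Iv v)) : X.Prop13v :=
  X.prop13v_of_psc G eV hV (hF0438 G hΩ).1 (hF0459 G hΩ).1 hgr hL hinf

/-- **[AbsTopII] Prop 1.3 (ix) (F-0277) modulo F-0438, graphicity, `Π_𝔾` slim nontrivial ([CombGC]
Rmk 1.1.3 — not a typed layer-L3 row), `Π_e ≤ I_e` and "`Π_e` abelian" for cusps.**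
[cite: MochizukiAbsTopII2013, Prop 1.3 (ix) p.12] [cite: MochizukiCombGC2007, Prop 1.2 p.8] -/
theorem prop13ix_of_pscOrigin [Nontrivial ↥X.PiG] (hslim : IsSlimGroup ↥X.PiG)
    (Ω : PSCOrigin.{u}) (hΩ : Ω.IsOfPSCType G) (hF0438 : PSCDatum.CommensurableTerminalityHolds Ω)
    (hN : ∀ e, ∃ δ : ConjAct ↥X.PiG, (X.nodeSub e).subgroupOf X.PiG = δ • G.nodeGp (eN e))
    (hC : ∀ e, ∃ δ : ConjAct ↥X.PiG, (X.cuspSub e).subgroupOf X.PiG = δ • G.cuspGp (eC e))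
    (hgr : ∀ h : X.PiH, ∃ α : ↥X.PiG ≃ₜ* ↥X.PiG,
      (∀ x : ↥X.PiG, ((α x : ↥X.PiG) : X.PiH) = h * x * h⁻¹) ∧ G.IsGraphic G α)
    (hii : ∀ e : X.Node, X.nodeSub e ≤ X.IvNode e)
    (hab : ∀ e : X.Cusp, ∀ x ∈ X.cuspSub e, ∀ y ∈ X.cuspSub e, x * y = y * x) : X.Prop13ix :=
  X.prop13ix_of_psc G eN eC hslim hN hC (hF0438 G hΩ).1 hgr hii hab

end DPSCData

end Literature.AnabelianGeometry.AbsoluteAnabelian
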